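import Summits.AtomisticToContinuum.Crystallization.Theorems.FreeSplittingCertificatesStrictSplittingRuleP1DemandBare

/-!
# `StrictSplittingRule` (stmt-AtomisticToContinuum-12560): cells are CONVEX; the VERTICAL Bravais readout bond `2h·e₃` of the first-order design is routed EXACTLY through the up/down tetrahedron pair (P1 interpolant object, part 33)

Route `FreeSplittingCertificates`, crux r3 `StrictSplittingRule` (H12⋆ = `stub_coreJointCoercive`), unit b2b-freesplit-B gen 24.
VALUE = the first brick of the READOUT allocation (R) of the demand side (HOME FAR-LEMMA-SPEC §14 (d)(3), §17 (c)(R)).  The landed first-order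
design (`…CoreFirstOrderDesign`, stencil `Y = {(0,1,0), (0,0,1), (0,−1,1), (2,0,0)}`) reads three IN-LAYER bonds — edges of the honeycomb cells, whose
differences are `G_Tᵀ y_t` on every cell containing the edge (`p1CellGrad_vertex_sub`, part 8) — and the VERTICAL Bravais bond `(2,0,0)` (site vector
`2h·e₃`), which is NOT a cell edge: it runs apex → base-centroid → apex through the down-tetrahedron below and the up-tetrahedron above the close-packed
triangle between the two sites.  Here:
* `sum_mul_vert_mem_p1RealCell` — real cells are convex: every convex combination of the four vertices lies in the cell (the facet functions are affine
  on `ℝ³`, `p1RealCell_eq`);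
* `p1Field_sub_of_mem` — on a cell the interpolant's increments are `G_Tᵀ(y′ − y)` for ANY two points of the cell;
* **`p1Field_vertical_sub_even` / `p1Field_vertical_sub_odd`** — for lattice values `V` and every site `q`:
  `V(q + (2,0,0)) − V(q) = h·(G_{T₁} + G_{T₂})ᵀ e₃`, `T₁ = (q − (0,1,1), 1)`, `T₂ = (q + (1,−1,−1), 1)` (even `q.1`), `T₁ = (q, 0)`, `T₂ = (q + (1,0,0), 0)` (odd `q.1`)
  — the straight route; by Cauchy–Schwarz `|Δ|² ≤ 2h²(|G_{T₁}ᵀe₃|² + |G_{T₂}ᵀe₃|²)` (`p1_vertical_sq_le`), the `e₃e₃ᵀ` capacity of the two tetrahedra.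
NOT a proof of H12⋆, NOT summit progress.  [folklore]
-/

noncomputable section

open Set Function
open scoped BigOperators

namespace Summit.AtomisticToContinuum.Crystallization.Theorems.StrictSplittingRuleBirth

open Literature.MathematicalPhysics.StatisticalMechanics
open Summit.AtomisticToContinuum.Crystallization.Theorems.PalmUnimodularRigidity.LayeredLawsSelectHcp

/-! ## Convexity of the real cells -/

/-- **Real cells are convex**: a convex combination of the four vertices lies in the cell. -/
theorem sum_mul_vert_mem_p1RealCell {a h : ℝ} (ha : a ≠ 0) (hh : h ≠ 0) (i : (ℤ × ℤ × ℤ) × Fin 6) {μ : Fin 4 → ℝ}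
    (hμ0 : ∀ m, 0 ≤ μ m) (hμ1 : ∑ m, μ m = 1) :
    (fun k => ∑ m : Fin 4, μ m * hcpSite a h (i.1 + p1VertOff (p1Par i.1) i.2 m) k) ∈ p1RealCell a h i := by
  rw [p1RealCell_eq]
  intro m'
  have hvert : ∀ m : Fin 4, 0 ≤ p1FacetFn a h i m' (fun k => hcpSite a h (i.1 + p1VertOff (p1Par i.1) i.2 m) k) := by
    intro m
    have hmem := p1Chart_vert_mem_p1RealCell ha hh i m
    rw [p1Chart_p1Vec_eq, p1RealCell_eq] at hmem
    exact hmem m'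
  -- the facet function is affine: evaluate at the convex combination
  have hfun : (fun k => ∑ m : Fin 4, μ m * hcpSite a h (i.1 + p1VertOff (p1Par i.1) i.2 m) k) =
      ∑ m : Fin 4, μ m • (fun k => hcpSite a h (i.1 + p1VertOff (p1Par i.1) i.2 m) k) := by
    funext k; simp [Finset.sum_apply, Pi.smul_apply, smul_eq_mul]
  have haff : p1FacetFn a h i m' (fun k => ∑ m : Fin 4, μ m * hcpSite a h (i.1 + p1VertOff (p1Par i.1) i.2 m) k) =
      ∑ m : Fin 4, μ m * p1FacetFn a h i m' (fun k => hcpSite a h (i.1 + p1VertOff (p1Par i.1) i.2 m) k) := by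
    rw [p1FacetFn_eq, hfun, map_sum]
    simp_rw [map_smul, smul_eq_mul]
    have h1 : p1FacetFn a h i m' 0 = ∑ m : Fin 4, μ m * p1FacetFn a h i m' 0 := by
      rw [← Finset.sum_mul, hμ1, one_mul]
    conv_rhs => rw [show (∑ m : Fin 4, μ m * p1FacetFn a h i m' (fun k => hcpSite a h (i.1 + p1VertOff (p1Par i.1) i.2 m) k)) =
      ∑ m : Fin 4, μ m * (p1FacetFn a h i m' 0 + p1FacetCLM a h i m' (fun k => hcpSite a h (i.1 + p1VertOff (p1Par i.1) i.2 m) k)) from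
        Finset.sum_congr rfl fun m _ => by rw [← p1FacetFn_eq]]
    simp_rw [mul_add, Finset.sum_add_distrib]
    rw [← h1]
  rw [haff]
  exact Finset.sum_nonneg fun m _ => mul_nonneg (hμ0 m) (hvert m)

/-- The centroid of three vertices (weights `⅓` each; repetitions allowed) lies in the cell. -/
theorem centroid_mem_p1RealCell {a h : ℝ} (ha : a ≠ 0) (hh : h ≠ 0) (i : (ℤ × ℤ × ℤ) × Fin 6) (m₁ m₂ m₃ : Fin 4) :
    (fun k => (hcpSite a h (i.1 + p1VertOff (p1Par i.1) i.2 m₁) k + hcpSite a h (i.1 + p1VertOff (p1Par i.1) i.2 m₂) k +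
      hcpSite a h (i.1 + p1VertOff (p1Par i.1) i.2 m₃) k) / 3) ∈ p1RealCell a h i := by
  classical
  set μ : Fin 4 → ℝ := fun m => (if m = m₁ then 1 / 3 else 0) + (if m = m₂ then 1 / 3 else 0) + (if m = m₃ then 1 / 3 else 0) with hμ
  have hμ0 : ∀ m, 0 ≤ μ m := fun m => by
    simp only [hμ]; positivity
  have hμ1 : ∑ m, μ m = 1 := by
    simp only [hμ, Finset.sum_add_distrib, Finset.sum_ite_eq', Finset.mem_univ, if_true]; norm_num
  have hmem := sum_mul_vert_mem_p1RealCell ha hh i hμ0 hμ1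
  convert hmem using 1
  funext k
  simp only [hμ, add_mul, ite_mul, zero_mul, Finset.sum_add_distrib, Finset.sum_ite_eq', Finset.mem_univ, if_true]
  ring

/-! ## Increments of the interpolant inside one cell -/

/-- **On a cell the interpolant's increments are `G_Tᵀ(y′ − y)`** for any two points of the cell. -/
theorem p1Field_sub_of_mem {a h : ℝ} (V : ℤ × ℤ × ℤ → (Fin 3 → ℝ)) {i : (ℤ × ℤ × ℤ) × Fin 6} {y y' : Fin 3 → ℝ}
    (hy : y ∈ p1RealCell a h i) (hy' : y' ∈ p1RealCell a h i) (k : Fin 3) :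
    p1Field a h V y' k - p1Field a h V y k =
      (y' 0 - y 0) * p1CellGrad a h V i 0 k + (y' 1 - y 1) * p1CellGrad a h V i 1 k + (y' 2 - y 2) * p1CellGrad a h V i 2 k := by
  rw [p1Field_eq_affine V hy, p1Field_eq_affine V hy']
  have hsub : (p1CellConst a h V i + p1CellMap a h V i y') k - (p1CellConst a h V i + p1CellMap a h V i y) k =
      p1CellMap a h V i (y' - y) k := by
    rw [map_sub]; simp
  rw [hsub, clm_apply_eq_sum_fpE]
  rfl

/-! ## The vertical Bravais bond through the tetrahedron pair -/

/-- Label values used below. -/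
theorem haggLabel_alt_values : haggLabel alternatingHagg 0 = 0 ∧ haggLabel alternatingHagg 1 = 1 ∧ haggLabel alternatingHagg (-1) = 1 ∧
    haggLabel alternatingHagg 2 = 0 :=
  ⟨haggLabel_alternating_of_even (by decide), haggLabel_alternating_of_odd (by decide), haggLabel_alternating_of_odd (by decide),
    haggLabel_alternating_of_even (by decide)⟩

/-- **The vertical readout bond, EVEN base layer**: for lattice values `V` and `q` with `q.1` even,
`V(q + (2,0,0)) − V(q) = h·(G_{T₁}ᵀe₃ + G_{T₂}ᵀe₃)` with `T₁ = (q − (0,1,1), 1)` (the down-tetrahedron with apex `q`) and `T₂ = (q + (1,−1,−1), 1)`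
(the up-tetrahedron with apex `q + (2,0,0)`), which share the close-packed triangle `{q+(1,0,0), q+(1,−1,0), q+(1,0,−1)}` whose centroid lies
straight above `y_q` at height `h`.  NOT a proof of H12⋆, NOT summit progress. -/
theorem p1Field_vertical_sub_even {a h : ℝ} (ha : a ≠ 0) (hh : h ≠ 0) (V : ℤ × ℤ × ℤ → (Fin 3 → ℝ)) (q : ℤ × ℤ × ℤ) (hq : Even q.1)
    (k : Fin 3) :
    V (q + (2, 0, 0)) k - V q k =
      h * (p1CellGrad a h V (q + (0, -1, -1), 1) 2 k + p1CellGrad a h V (q + (1, -1, -1), 1) 2 k) := by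
  obtain ⟨hL0, hL1, hLm1, hL2⟩ := haggLabel_alt_values
  have hp1 : p1Par (q + (0, -1, -1)) = true := by simp [p1Par, hq]
  have hp2 : p1Par (q + (1, -1, -1)) = false := by
    simp only [p1Par, Prod.fst_add, decide_eq_false_iff_not, Int.not_even_iff_odd]; exact hq.add_one
  -- the centroid of the shared triangle
  set c : Fin 3 → ℝ := fun k => (hcpSite a h (q + (1, 0, 0)) k + hcpSite a h (q + (1, -1, 0)) k + hcpSite a h (q + (1, 0, -1)) k) / 3
    with hc
  -- vertex bookkeeping of the two tetrahedra
  have v10 : q + (0, -1, -1) + p1VertOff (p1Par (q + (0, -1, -1))) 1 0 = q + (1, 0, 0) := by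
    ext <;> simp [hp1, p1VertOff, add_assoc]
  have v11 : q + (0, -1, -1) + p1VertOff (p1Par (q + (0, -1, -1))) 1 1 = q := by
    ext <;> simp [hp1, p1VertOff, add_assoc]
  have v12 : q + (0, -1, -1) + p1VertOff (p1Par (q + (0, -1, -1))) 1 2 = q + (1, -1, 0) := by
    ext <;> simp [hp1, p1VertOff, add_assoc]
  have v13 : q + (0, -1, -1) + p1VertOff (p1Par (q + (0, -1, -1))) 1 3 = q + (1, 0, -1) := by
    ext <;> simp [hp1, p1VertOff, add_assoc]
  have v20 : q + (1, -1, -1) + p1VertOff (p1Par (q + (1, -1, -1))) 1 0 = q + (1, 0, 0) := by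
    ext <;> simp [hp2, p1VertOff, add_assoc]
  have v21 : q + (1, -1, -1) + p1VertOff (p1Par (q + (1, -1, -1))) 1 1 = q + (2, 0, 0) := by
    ext <;> simp [hp2, p1VertOff, add_assoc]
  have v22 : q + (1, -1, -1) + p1VertOff (p1Par (q + (1, -1, -1))) 1 2 = q + (1, -1, 0) := by
    ext <;> simp [hp2, p1VertOff, add_assoc]
  have v23 : q + (1, -1, -1) + p1VertOff (p1Par (q + (1, -1, -1))) 1 3 = q + (1, 0, -1) := by
    ext <;> simp [hp2, p1VertOff, add_assoc]
  -- memberships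
  have hc1 : c ∈ p1RealCell a h (q + (0, -1, -1), 1) := by
    have := centroid_mem_p1RealCell ha hh (q + (0, -1, -1), (1 : Fin 6)) 0 2 3
    dsimp only at this
    rw [v10, v12, v13] at this
    exact this
  have hc2 : c ∈ p1RealCell a h (q + (1, -1, -1), 1) := by
    have := centroid_mem_p1RealCell ha hh (q + (1, -1, -1), (1 : Fin 6)) 0 2 3
    dsimp only at this
    rw [v20, v22, v23] at this
    exact this
  have hq1 : (fun k => hcpSite a h q k) ∈ p1RealCell a h (q + (0, -1, -1), 1) := by
    have := p1Chart_vert_mem_p1RealCell ha hh (q + (0, -1, -1), (1 : Fin 6)) 1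
    rw [p1Chart_p1Vec_eq] at this
    dsimp only at this
    rw [v11] at this
    exact this
  have hq2 : (fun k => hcpSite a h (q + (2, 0, 0)) k) ∈ p1RealCell a h (q + (1, -1, -1), 1) := by
    have := p1Chart_vert_mem_p1RealCell ha hh (q + (1, -1, -1), (1 : Fin 6)) 1
    rw [p1Chart_p1Vec_eq] at this
    dsimp only at this
    rw [v21] at this
    exact this
  -- the two increments
  have h1 := p1Field_sub_of_mem V hq1 hc1 k
  have h2 := p1Field_sub_of_mem V hc2 hq2 k
  rw [p1Field_hcpSite ha hh] at h1 h2
  -- coordinates: `y_{q+d} − y_q = y_d` (even base layer)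
  have hd : ∀ d : ℤ × ℤ × ℤ, ∀ j, hcpSite a h (q + d) j - hcpSite a h q j = hcpSite a h d j := by
    intro d j; rw [hcpSite_add_of_even a h hq, PiLp.add_apply]; ring
  have s0 : hcpSite a h ((1 : ℤ), (0 : ℤ), (0 : ℤ)) 0 + hcpSite a h ((1 : ℤ), (-1 : ℤ), (0 : ℤ)) 0 +
      hcpSite a h ((1 : ℤ), (0 : ℤ), (-1 : ℤ)) 0 = 0 := by
    simp only [hcpSite_apply_zero, hL1]; push_cast; ring
  have s1 : hcpSite a h ((1 : ℤ), (0 : ℤ), (0 : ℤ)) 1 + hcpSite a h ((1 : ℤ), (-1 : ℤ), (0 : ℤ)) 1 +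
      hcpSite a h ((1 : ℤ), (0 : ℤ), (-1 : ℤ)) 1 = 0 := by
    simp only [hcpSite_apply_one, hL1]; push_cast; ring
  have s2 : hcpSite a h ((1 : ℤ), (0 : ℤ), (0 : ℤ)) 2 + hcpSite a h ((1 : ℤ), (-1 : ℤ), (0 : ℤ)) 2 +
      hcpSite a h ((1 : ℤ), (0 : ℤ), (-1 : ℤ)) 2 = 3 * h := by
    simp only [hcpSite_apply_two]; push_cast; ring
  have t0 : hcpSite a h ((2 : ℤ), (0 : ℤ), (0 : ℤ)) 0 = 0 := by simp only [hcpSite_apply_zero, hL2]; push_cast; ring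
  have t1 : hcpSite a h ((2 : ℤ), (0 : ℤ), (0 : ℤ)) 1 = 0 := by simp only [hcpSite_apply_one, hL2]; push_cast; ring
  have t2 : hcpSite a h ((2 : ℤ), (0 : ℤ), (0 : ℤ)) 2 = 2 * h := by simp only [hcpSite_apply_two]; push_cast; ring
  have hc0 : c 0 - hcpSite a h q 0 = 0 := by
    show (hcpSite a h (q + (1, 0, 0)) 0 + hcpSite a h (q + (1, -1, 0)) 0 + hcpSite a h (q + (1, 0, -1)) 0) / 3 - hcpSite a h q 0 = 0
    linarith [hd (1, 0, 0) 0, hd (1, -1, 0) 0, hd (1, 0, -1) 0, s0]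
  have hc1' : c 1 - hcpSite a h q 1 = 0 := by
    show (hcpSite a h (q + (1, 0, 0)) 1 + hcpSite a h (q + (1, -1, 0)) 1 + hcpSite a h (q + (1, 0, -1)) 1) / 3 - hcpSite a h q 1 = 0
    linarith [hd (1, 0, 0) 1, hd (1, -1, 0) 1, hd (1, 0, -1) 1, s1]
  have hc2' : c 2 - hcpSite a h q 2 = h := by
    show (hcpSite a h (q + (1, 0, 0)) 2 + hcpSite a h (q + (1, -1, 0)) 2 + hcpSite a h (q + (1, 0, -1)) 2) / 3 - hcpSite a h q 2 = h
    linarith [hd (1, 0, 0) 2, hd (1, -1, 0) 2, hd (1, 0, -1) 2, s2]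
  have ht0 : hcpSite a h (q + (2, 0, 0)) 0 - c 0 = 0 := by linarith [hd (2, 0, 0) 0, t0, hc0]
  have ht1 : hcpSite a h (q + (2, 0, 0)) 1 - c 1 = 0 := by linarith [hd (2, 0, 0) 1, t1, hc1']
  have ht2 : hcpSite a h (q + (2, 0, 0)) 2 - c 2 = h := by linarith [hd (2, 0, 0) 2, t2, hc2']
  simp only [hc0, hc1', hc2'] at h1
  simp only [ht0, ht1, ht2] at h2
  linear_combination h1 + h2

/-- **The vertical readout bond, ODD base layer**: for `q` with `q.1` odd,
`V(q + (2,0,0)) − V(q) = h·(G_{T₁}ᵀe₃ + G_{T₂}ᵀe₃)` with `T₁ = (q, 0)` and `T₂ = (q + (1,0,0), 0)` (shared triangle `{q+(1,0,0), q+(1,1,0), q+(1,0,1)}`).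
NOT a proof of H12⋆, NOT summit progress. -/
theorem p1Field_vertical_sub_odd {a h : ℝ} (ha : a ≠ 0) (hh : h ≠ 0) (V : ℤ × ℤ × ℤ → (Fin 3 → ℝ)) (q : ℤ × ℤ × ℤ) (hq : Odd q.1)
    (k : Fin 3) :
    V (q + (2, 0, 0)) k - V q k = h * (p1CellGrad a h V (q, 0) 2 k + p1CellGrad a h V (q + (1, 0, 0), 0) 2 k) := by
  obtain ⟨hL0, hL1, hLm1, hL2⟩ := haggLabel_alt_values
  have hp1 : p1Par q = false := by
    simp only [p1Par, decide_eq_false_iff_not, Int.not_even_iff_odd]; exact hq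
  have hp2 : p1Par (q + (1, 0, 0)) = true := by
    simp only [p1Par, Prod.fst_add, decide_eq_true_eq]; exact hq.add_one
  set c : Fin 3 → ℝ := fun k => (hcpSite a h (q + (1, 0, 0)) k + hcpSite a h (q + (1, 1, 0)) k + hcpSite a h (q + (1, 0, 1)) k) / 3
    with hc
  have v10 : q + p1VertOff (p1Par q) 0 0 = q + (1, 0, 0) := by ext <;> simp [hp1, p1VertOff]
  have v11 : q + p1VertOff (p1Par q) 0 1 = q := by
    ext <;> simp [hp1, p1VertOff]
  have v12 : q + p1VertOff (p1Par q) 0 2 = q + (1, 1, 0) := by ext <;> simp [hp1, p1VertOff]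
  have v13 : q + p1VertOff (p1Par q) 0 3 = q + (1, 0, 1) := by ext <;> simp [hp1, p1VertOff]
  have v20 : q + (1, 0, 0) + p1VertOff (p1Par (q + (1, 0, 0))) 0 0 = q + (1, 0, 0) := by
    ext <;> simp [hp2, p1VertOff, add_assoc]
  have v21 : q + (1, 0, 0) + p1VertOff (p1Par (q + (1, 0, 0))) 0 1 = q + (2, 0, 0) := by
    ext <;> simp [hp2, p1VertOff, add_assoc]
  have v22 : q + (1, 0, 0) + p1VertOff (p1Par (q + (1, 0, 0))) 0 2 = q + (1, 1, 0) := by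
    ext <;> simp [hp2, p1VertOff, add_assoc]
  have v23 : q + (1, 0, 0) + p1VertOff (p1Par (q + (1, 0, 0))) 0 3 = q + (1, 0, 1) := by
    ext <;> simp [hp2, p1VertOff, add_assoc]
  have hc1 : c ∈ p1RealCell a h (q, 0) := by
    have := centroid_mem_p1RealCell ha hh (q, (0 : Fin 6)) 0 2 3
    dsimp only at this
    rw [v10, v12, v13] at this
    exact this
  have hc2 : c ∈ p1RealCell a h (q + (1, 0, 0), 0) := by
    have := centroid_mem_p1RealCell ha hh (q + (1, 0, 0), (0 : Fin 6)) 0 2 3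
    dsimp only at this
    rw [v20, v22, v23] at this
    exact this
  have hq1 : (fun k => hcpSite a h q k) ∈ p1RealCell a h (q, 0) := by
    have := p1Chart_vert_mem_p1RealCell ha hh (q, (0 : Fin 6)) 1
    rw [p1Chart_p1Vec_eq] at this
    dsimp only at this
    rw [v11] at this
    exact this
  have hq2 : (fun k => hcpSite a h (q + (2, 0, 0)) k) ∈ p1RealCell a h (q + (1, 0, 0), 0) := by
    have := p1Chart_vert_mem_p1RealCell ha hh (q + (1, 0, 0), (0 : Fin 6)) 1
    rw [p1Chart_p1Vec_eq] at this
    dsimp only at this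
    rw [v21] at this
    exact this
  have h1 := p1Field_sub_of_mem V hq1 hc1 k
  have h2 := p1Field_sub_of_mem V hc2 hq2 k
  rw [p1Field_hcpSite ha hh] at h1 h2
  -- coordinates: `y_{q+d} − y_q = −y_{−d}` (odd base layer)
  have hd : ∀ d d' : ℤ × ℤ × ℤ, d' = -d → ∀ j, hcpSite a h (q + d) j - hcpSite a h q j = -hcpSite a h d' j := by
    intro d d' hdd j
    have e1 : q + d = q - d' := by rw [hdd]; abel
    rw [e1, hcpSite_sub_of_odd a h hq, PiLp.sub_apply]; ring
  have n1 : ((-1 : ℤ), (0 : ℤ), (0 : ℤ)) = -((1 : ℤ), (0 : ℤ), (0 : ℤ)) := Prod.ext (by simp) (Prod.ext (by simp) (by simp))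
  have n2 : ((-1 : ℤ), (-1 : ℤ), (0 : ℤ)) = -((1 : ℤ), (1 : ℤ), (0 : ℤ)) := Prod.ext (by simp) (Prod.ext (by simp) (by simp))
  have n3 : ((-1 : ℤ), (0 : ℤ), (-1 : ℤ)) = -((1 : ℤ), (0 : ℤ), (1 : ℤ)) := Prod.ext (by simp) (Prod.ext (by simp) (by simp))
  have n4 : ((-2 : ℤ), (0 : ℤ), (0 : ℤ)) = -((2 : ℤ), (0 : ℤ), (0 : ℤ)) := Prod.ext (by simp) (Prod.ext (by simp) (by simp))
  have hLm2 : haggLabel alternatingHagg (-2) = 0 := haggLabel_alternating_of_even (by decide)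
  have s0 : -hcpSite a h ((-1 : ℤ), (0 : ℤ), (0 : ℤ)) 0 + -hcpSite a h ((-1 : ℤ), (-1 : ℤ), (0 : ℤ)) 0 +
      -hcpSite a h ((-1 : ℤ), (0 : ℤ), (-1 : ℤ)) 0 = 0 := by
    simp only [hcpSite_apply_zero, hLm1]; push_cast; ring
  have s1 : -hcpSite a h ((-1 : ℤ), (0 : ℤ), (0 : ℤ)) 1 + -hcpSite a h ((-1 : ℤ), (-1 : ℤ), (0 : ℤ)) 1 +
      -hcpSite a h ((-1 : ℤ), (0 : ℤ), (-1 : ℤ)) 1 = 0 := by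
    simp only [hcpSite_apply_one, hLm1]; push_cast; ring
  have s2 : -hcpSite a h ((-1 : ℤ), (0 : ℤ), (0 : ℤ)) 2 + -hcpSite a h ((-1 : ℤ), (-1 : ℤ), (0 : ℤ)) 2 +
      -hcpSite a h ((-1 : ℤ), (0 : ℤ), (-1 : ℤ)) 2 = 3 * h := by
    simp only [hcpSite_apply_two]; push_cast; ring
  have t0 : -hcpSite a h ((-2 : ℤ), (0 : ℤ), (0 : ℤ)) 0 = 0 := by simp only [hcpSite_apply_zero, hLm2]; push_cast; ring
  have t1 : -hcpSite a h ((-2 : ℤ), (0 : ℤ), (0 : ℤ)) 1 = 0 := by simp only [hcpSite_apply_one, hLm2]; push_cast; ring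
  have t2 : -hcpSite a h ((-2 : ℤ), (0 : ℤ), (0 : ℤ)) 2 = 2 * h := by simp only [hcpSite_apply_two]; push_cast; ring
  have hc0 : c 0 - hcpSite a h q 0 = 0 := by
    show (hcpSite a h (q + (1, 0, 0)) 0 + hcpSite a h (q + (1, 1, 0)) 0 + hcpSite a h (q + (1, 0, 1)) 0) / 3 - hcpSite a h q 0 = 0
    linarith [hd (1, 0, 0) _ n1 0, hd (1, 1, 0) _ n2 0, hd (1, 0, 1) _ n3 0, s0]
  have hc1' : c 1 - hcpSite a h q 1 = 0 := by
    show (hcpSite a h (q + (1, 0, 0)) 1 + hcpSite a h (q + (1, 1, 0)) 1 + hcpSite a h (q + (1, 0, 1)) 1) / 3 - hcpSite a h q 1 = 0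
    linarith [hd (1, 0, 0) _ n1 1, hd (1, 1, 0) _ n2 1, hd (1, 0, 1) _ n3 1, s1]
  have hc2' : c 2 - hcpSite a h q 2 = h := by
    show (hcpSite a h (q + (1, 0, 0)) 2 + hcpSite a h (q + (1, 1, 0)) 2 + hcpSite a h (q + (1, 0, 1)) 2) / 3 - hcpSite a h q 2 = h
    linarith [hd (1, 0, 0) _ n1 2, hd (1, 1, 0) _ n2 2, hd (1, 0, 1) _ n3 2, s2]
  have ht0 : hcpSite a h (q + (2, 0, 0)) 0 - c 0 = 0 := by linarith [hd (2, 0, 0) _ n4 0, t0, hc0]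
  have ht1 : hcpSite a h (q + (2, 0, 0)) 1 - c 1 = 0 := by linarith [hd (2, 0, 0) _ n4 1, t1, hc1']
  have ht2 : hcpSite a h (q + (2, 0, 0)) 2 - c 2 = h := by linarith [hd (2, 0, 0) _ n4 2, t2, hc2']
  simp only [hc0, hc1', hc2'] at h1
  simp only [ht0, ht1, ht2] at h2
  linear_combination h1 + h2

/-- **Cauchy–Schwarz for the straight route**: `|h(x + y)|²-type bound `(h(g₁ + g₂))² ≤ 2h²(g₁² + g₂²)` componentwise, summed:
`Σ_k (h(G₁ 2 k + G₂ 2 k))² ≤ 2h²(Σ_k G₁ 2 k² + Σ_k G₂ 2 k²)` — the `e₃e₃ᵀ` capacity of the two tetrahedra. -/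
theorem p1_vertical_sq_le (h : ℝ) (G₁ G₂ : Fin 3 → Fin 3 → ℝ) :
    (h * (G₁ 2 0 + G₂ 2 0)) ^ 2 + (h * (G₁ 2 1 + G₂ 2 1)) ^ 2 + (h * (G₁ 2 2 + G₂ 2 2)) ^ 2 ≤
      2 * h ^ 2 * ((G₁ 2 0 ^ 2 + G₁ 2 1 ^ 2 + G₁ 2 2 ^ 2) + (G₂ 2 0 ^ 2 + G₂ 2 1 ^ 2 + G₂ 2 2 ^ 2)) := by
  nlinarith [sq_nonneg (G₁ 2 0 - G₂ 2 0), sq_nonneg (G₁ 2 1 - G₂ 2 1), sq_nonneg (G₁ 2 2 - G₂ 2 2), sq_nonneg h]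

end Summit.AtomisticToContinuum.Crystallization.Theorems.StrictSplittingRuleBirth
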